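import Summits.SmoothPoincare4.SmoothPoincare4.Theorems.ConvexBisectionAcyclicBisectionExistsSeamTwistSignFrame
import HarnessLib

/-!
# Seam transport, ST4 (4b, algebra): the page determinant of a linear map between flat page points
(wave 5, brick X3-2a of sub-node ST4 `node_ST4_twistSign` of node T3c-2 `node_seam_transport` of
stub `stub_T3_dualPresentation` (T3), line `modp-braid-orbits`, crux
`ConvexBisection.AcyclicBisectionExists`, item stmt-SmoothPoincare4-10508; registered sub-goal
`helper_pageDet_comp`)

At a point `q ≠ 0` of `ℂ² = ℝ⁴` the complex tangent line of the page through `q` is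
`L_q = ker dΦ_q = ℂ · τ(q)` with the CANONICAL PAGE TANGENT `τ(q) = pageVec g q = (b, −a)`
(`dΦ_q = a dx + b dy`).  For a real-linear `Λ : ℝ⁴ → ℝ⁴` the PAGE DETERMINANT at `q` is
`pageDet g Λ q = ⟪Λ(iτ), iΛτ⟫`: when `Λ` maps `L_q` into a complex line `L_{q'}` it is
`‖τ(q')‖² · det (Λ|L_q : (τ, iτ) → (τ', iτ'))`, so its SIGN is the page-orientation character of `Λ`.
This file is the bookkeeping of that sign:

* §1 `pageVec`: `dΦ(τ) = dΦ(iτ) = 0`, `τ ≠ 0` off the origin, continuity;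
* §2 `pageDet`: the identity has `pageDet = ‖τ‖² > 0` (`pageDet_id`); for a non-zero `T ∈ L_q`,
  `⟪Λ(iT), iΛT⟫ = c · pageDet g Λ q` with `c > 0` (`inner_cplxJ_map_eq_mul_pageDet`: the knot's own
  velocity may replace `τ`); **multiplicativity** `pageDet (Λ₂ ∘ Λ₁) q · ‖τ(q')‖² =
  pageDet Λ₁ q · pageDet Λ₂ q'` when `Λ₁ (L_q) ⊆ L_{q'}` (`pageDet_comp`, registered as
  `helper_pageDet_comp`); non-vanishing for maps injective on `L_q` (`pageDet_ne_zero`); joint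
  continuity in `(Λ, q)` (`continuous_pageDet_family`), so that along a path of such maps the sign is constant
  (`pageDet_pos_of_path`).

Everything is proved; no named facts, no `sorry`.  References: J. B. Etnyre, T. Fuller, IMRN 2006,
Thm. 1 (proof, p. 8) [EtnyreFuller2006]; P. Griffiths, J. Harris, *Principles of Algebraic Geometry*
(1978), Ch. 0 §2 (complex lines are canonically oriented) [GriffithsHarris1978].
-/

noncomputable section

set_option linter.dupNamespace false

open scoped ComplexConjugate Topology
open Set Function Complex
open Literature.Topology.FourManifolds Literature.Topology.FourManifolds.LefschetzBase

namespace Summit.SmoothPoincare4.SmoothPoincare4.Theorems.AcyclicBisectionExists.ModpBraidOrbits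

variable {g : ℕ}

/-! ## §1 The canonical page tangent `τ(q) = (b, −a)` -/

/-- **The canonical page tangent** `τ(q) = (b, −a)` (`a = ∂Φ/∂x`, `b = ∂Φ/∂y` at `q`): a non-zero
vector of the complex tangent line `L_q = ker dΦ_q` of the page through `q`, depending smoothly on
`q`. [folklore] -/
def pageVec (g : ℕ) (q : EuclideanSpace ℝ (Fin 4)) : EuclideanSpace ℝ (Fin 4) :=
  LefschetzBase.mk (dPhiY q) (-dPhiX g q)

/-- `cx τ = b`. [folklore] -/
@[simp] theorem cx_pageVec (q : EuclideanSpace ℝ (Fin 4)) : cx (pageVec g q) = dPhiY q := by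
  simp [pageVec]

/-- `cy τ = -a`. [folklore] -/
@[simp] theorem cy_pageVec (q : EuclideanSpace ℝ (Fin 4)) : cy (pageVec g q) = -dPhiX g q := by
  simp [pageVec]

/-- `τ(q) ∈ ker dΦ_q`. [folklore] -/
theorem dPhi_pageVec (q : EuclideanSpace ℝ (Fin 4)) :
    dPhiX g q * cx (pageVec g q) + dPhiY q * cy (pageVec g q) = 0 := by
  rw [cx_pageVec, cy_pageVec]; ring

/-- `iτ(q) ∈ ker dΦ_q`. [folklore] -/
theorem dPhi_cplxJ_pageVec (q : EuclideanSpace ℝ (Fin 4)) :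
    dPhiX g q * cx (cplxJ (pageVec g q)) + dPhiY q * cy (cplxJ (pageVec g q)) = 0 := by
  rw [cx_cplxJ, cy_cplxJ, cx_pageVec, cy_pageVec]; ring

/-- `τ(q) ≠ 0` off the origin. [folklore] -/
theorem pageVec_ne_zero {q : EuclideanSpace ℝ (Fin 4)} (hq : q ≠ 0) : pageVec g q ≠ 0 := by
  intro h0
  rcases dPhiX_ne_zero_or (g := g) hq with ha | hb
  · apply ha
    have := congrArg cy h0
    rw [cy_pageVec] at this
    simpa using this
  · apply hb
    have := congrArg cx h0
    rw [cx_pageVec] at this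
    simpa using this

/-- `τ` is continuous. [folklore] -/
theorem continuous_pageVec : Continuous (pageVec g) :=
  continuous_mk.comp (continuous_dPhiY.prodMk (continuous_dPhiX g).neg)

/-- `i (i X) = -X`. [folklore] -/
theorem cplxJ_cplxJ_eq_neg (X : EuclideanSpace ℝ (Fin 4)) : cplxJ (cplxJ X) = -X := by
  apply ext_cx_cy
  · rw [cx_cplxJ, cx_cplxJ, ← mul_assoc, Complex.I_mul_I, show cx (-X) = -cx X by
      rw [← neg_one_smul ℝ X, cx_smul]; push_cast; ring]
    ring
  · rw [cy_cplxJ, cy_cplxJ, ← mul_assoc, Complex.I_mul_I, show cy (-X) = -cy X by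
      rw [← neg_one_smul ℝ X, cy_smul]; push_cast; ring]
    ring

/-- `⟪iX, iY⟫ = ⟪X, Y⟫`: `i` is a real isometry. [folklore] -/
theorem inner_cplxJ_cplxJ_eq (X Y : EuclideanSpace ℝ (Fin 4)) :
    inner ℝ (cplxJ X) (cplxJ Y) = inner ℝ X Y := by
  rw [inner_eq_re_herm, inner_eq_re_herm, cx_cplxJ, cy_cplxJ, cx_cplxJ, cy_cplxJ]
  simp only [map_mul, Complex.conj_I]
  ring_nf
  rw [Complex.I_sq]
  ring_nf

/-! ## §2 The page determinant -/

/-- **The page determinant** of a linear map `Λ` of `ℝ⁴` at the source point `q`: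
`pageDet g Λ q = ⟪Λ(iτ), iΛτ⟫`, `τ = pageVec g q`.  If `Λ` maps `L_q` into a complex line `L_{q'}`,
this is `‖τ(q')‖²` times the determinant of `Λ|L_q` in the complex-positive bases `(τ, iτ)`,
`(τ', iτ')`; its sign is the page-orientation character of `Λ`. [cite: EtnyreFuller2006, Thm. 1 (proof, p. 8)] -/
def pageDet (g : ℕ) (Λ : EuclideanSpace ℝ (Fin 4) →L[ℝ] EuclideanSpace ℝ (Fin 4))
    (q : EuclideanSpace ℝ (Fin 4)) : ℝ :=
  inner ℝ (Λ (cplxJ (pageVec g q))) (cplxJ (Λ (pageVec g q)))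

/-- The identity has page determinant `‖τ‖² > 0`. [folklore] -/
theorem pageDet_id {q : EuclideanSpace ℝ (Fin 4)} (hq : q ≠ 0) :
    0 < pageDet g (ContinuousLinearMap.id ℝ _) q := by
  unfold pageDet
  rw [ContinuousLinearMap.id_apply, ContinuousLinearMap.id_apply, inner_cplxJ_cplxJ_eq,
    real_inner_self_eq_norm_sq]
  have := pageVec_ne_zero (g := g) hq
  positivity

/-- Expansion of the Kähler pairing of two real combinations of `A`, `B` against `i(·)`:
`⟪α A + β B, i (γ A + δ B)⟫ = (β γ − α δ) ⟪B, iA⟫`. [folklore] -/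
theorem inner_comb_cplxJ_comb (A B : EuclideanSpace ℝ (Fin 4)) (α β γ δ : ℝ) :
    inner ℝ (α • A + β • B) (cplxJ (γ • A + δ • B)) = (β * γ - α * δ) * inner ℝ B (cplxJ A) := by
  simp only [cplxJ_add, cplxJ_smul, inner_add_left, inner_add_right, real_inner_smul_left,
    real_inner_smul_right, inner_cplxJ_self]
  rw [inner_cplxJ_antisymm A B]
  ring

/-- A vector of `L_q` written in the frame `(τ, iτ)`: `X = (Re z) τ + (Im z) iτ`. [folklore] -/
theorem exists_eq_comb_pageVec {q X : EuclideanSpace ℝ (Fin 4)} (hq : q ≠ 0)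
    (hX : dPhiX g q * cx X + dPhiY q * cy X = 0) :
    ∃ z : ℂ, X = z.re • pageVec g q + z.im • cplxJ (pageVec g q) :=
  ⟨(cx X * conj (cx (pageVec g q)) + cy X * conj (cy (pageVec g q))) / ((‖pageVec g q‖ ^ 2 : ℝ) : ℂ),
    by rw [← mk_mul_eq_add_smul]
       exact eq_mk_mul_of_dPhi_eq_zero hq (pageVec_ne_zero hq) (dPhi_pageVec q) hX⟩

/-- **The knot's velocity may replace `τ`**: for a non-zero `T ∈ L_q`,
`⟪Λ(iT), iΛT⟫ = c · pageDet g Λ q` with `c = ‖z‖² > 0`, `T = z · τ`. [folklore] -/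
theorem inner_cplxJ_map_eq_mul_pageDet (Λ : EuclideanSpace ℝ (Fin 4) →L[ℝ] EuclideanSpace ℝ (Fin 4))
    {q T : EuclideanSpace ℝ (Fin 4)} (hq : q ≠ 0) (hT : T ≠ 0)
    (hTL : dPhiX g q * cx T + dPhiY q * cy T = 0) :
    ∃ c : ℝ, 0 < c ∧ inner ℝ (Λ (cplxJ T)) (cplxJ (Λ T)) = c * pageDet g Λ q := by
  obtain ⟨z, hz⟩ := exists_eq_comb_pageVec (g := g) hq hTL
  have hz0 : z ≠ 0 := by
    rintro rfl
    apply hT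
    rw [hz]; simp
  refine ⟨Complex.normSq z, Complex.normSq_pos.2 hz0, ?_⟩
  have hiT : cplxJ T = (-z.im) • pageVec g q + z.re • cplxJ (pageVec g q) := by
    rw [hz, cplxJ_add, cplxJ_smul, cplxJ_smul, cplxJ_cplxJ_eq_neg, smul_neg, ← neg_smul, add_comm]
  unfold pageDet
  rw [hiT, hz, map_add, map_smul, map_smul, map_add, map_smul, map_smul, inner_comb_cplxJ_comb,
    Complex.normSq_apply]
  ring

/-- **Multiplicativity of the page determinant.**  If `Λ₁` maps `τ(q)` and `iτ(q)` into the complex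
line `L_{q'}` (`q' ≠ 0`), then for every `Λ₂`,
`pageDet (Λ₂ ∘ Λ₁) q · ‖τ(q')‖² = pageDet Λ₁ q · pageDet Λ₂ q'` — the determinant of a composite of
line maps is the product of the determinants. [cite: GriffithsHarris1978, Ch. 0 §2] -/
theorem pageDet_comp (Λ₁ Λ₂ : EuclideanSpace ℝ (Fin 4) →L[ℝ] EuclideanSpace ℝ (Fin 4))
    {q q' : EuclideanSpace ℝ (Fin 4)} (hq' : q' ≠ 0)
    (h1 : dPhiX g q' * cx (Λ₁ (pageVec g q)) + dPhiY q' * cy (Λ₁ (pageVec g q)) = 0)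
    (h2 : dPhiX g q' * cx (Λ₁ (cplxJ (pageVec g q))) + dPhiY q' * cy (Λ₁ (cplxJ (pageVec g q))) = 0) :
    pageDet g (Λ₂.comp Λ₁) q * ‖pageVec g q'‖ ^ 2 = pageDet g Λ₁ q * pageDet g Λ₂ q' := by
  obtain ⟨z, hz⟩ := exists_eq_comb_pageVec (g := g) hq' h1
  obtain ⟨z', hz'⟩ := exists_eq_comb_pageVec (g := g) hq' h2
  have e1 : pageDet g Λ₁ q = (z'.im * z.re - z'.re * z.im) * ‖pageVec g q'‖ ^ 2 := by
    unfold pageDet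
    rw [hz, hz', inner_comb_cplxJ_comb, inner_cplxJ_cplxJ_eq, real_inner_self_eq_norm_sq]
  have e2 : pageDet g (Λ₂.comp Λ₁) q = (z'.im * z.re - z'.re * z.im) * pageDet g Λ₂ q' := by
    unfold pageDet
    rw [ContinuousLinearMap.comp_apply, ContinuousLinearMap.comp_apply, hz, hz', map_add, map_smul,
      map_smul, map_add, map_smul, map_smul, inner_comb_cplxJ_comb]
  rw [e1, e2]; ring

/-- **The page determinant of a map injective on `L_q` and mapping it into a complex line does not
vanish.** [folklore] -/
theorem pageDet_ne_zero (Λ : EuclideanSpace ℝ (Fin 4) →L[ℝ] EuclideanSpace ℝ (Fin 4))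
    {q q' : EuclideanSpace ℝ (Fin 4)} (hq : q ≠ 0) (hq' : q' ≠ 0)
    (hinj : ∀ X, dPhiX g q * cx X + dPhiY q * cy X = 0 → Λ X = 0 → X = 0)
    (h1 : dPhiX g q' * cx (Λ (pageVec g q)) + dPhiY q' * cy (Λ (pageVec g q)) = 0)
    (h2 : dPhiX g q' * cx (Λ (cplxJ (pageVec g q))) + dPhiY q' * cy (Λ (cplxJ (pageVec g q))) = 0) :
    pageDet g Λ q ≠ 0 :=
  inner_cplxJ_map_ne_zero Λ.toLinearMap hq' (pageVec_ne_zero hq) (dPhi_pageVec q) hinj h1 h2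

/-- **Joint continuity of the page determinant**: along continuous families `t ↦ Λ_t`, `t ↦ q_t`,
`t ↦ pageDet g Λ_t q_t` is continuous. [folklore] -/
theorem continuous_pageDet_family {X : Type*} [TopologicalSpace X]
    {Λ : X → (EuclideanSpace ℝ (Fin 4) →L[ℝ] EuclideanSpace ℝ (Fin 4))}
    {q : X → EuclideanSpace ℝ (Fin 4)} (hΛ : Continuous Λ) (hq : Continuous q) :
    Continuous fun x => pageDet g (Λ x) (q x) := by
  unfold pageDet
  have hτ : Continuous fun x => pageVec g (q x) := continuous_pageVec.comp hq
  exact (hΛ.clm_apply (continuous_cplxJ.comp hτ)).inner (continuous_cplxJ.comp (hΛ.clm_apply hτ))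

/-- The same on a set. [folklore] -/
theorem continuousOn_pageDet_family {X : Type*} [TopologicalSpace X]
    {Λ : X → (EuclideanSpace ℝ (Fin 4) →L[ℝ] EuclideanSpace ℝ (Fin 4))}
    {q : X → EuclideanSpace ℝ (Fin 4)} {s : Set X} (hΛ : ContinuousOn Λ s) (hq : ContinuousOn q s) :
    ContinuousOn (fun x => pageDet g (Λ x) (q x)) s := by
  unfold pageDet
  have hτ : ContinuousOn (fun x => pageVec g (q x)) s := continuous_pageVec.comp_continuousOn hq
  exact (hΛ.clm_apply (continuous_cplxJ.comp_continuousOn hτ)).inner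
    (continuous_cplxJ.comp_continuousOn (hΛ.clm_apply hτ))

/-- **The sign of the page determinant is constant along a path of non-degenerate maps**: if
`t ↦ pageDet g Λ_t q_t` is continuous on `[0, 1]`, never vanishes there, and is positive at `t = 0`,
it is positive at `t = 1` (intermediate value theorem). [folklore] -/
theorem pageDet_pos_of_path {Λ : ℝ → (EuclideanSpace ℝ (Fin 4) →L[ℝ] EuclideanSpace ℝ (Fin 4))}
    {q : ℝ → EuclideanSpace ℝ (Fin 4)}
    (hc : ContinuousOn (fun t => pageDet g (Λ t) (q t)) (Icc 0 1))
    (hne : ∀ t ∈ Icc (0 : ℝ) 1, pageDet g (Λ t) (q t) ≠ 0) (h0 : 0 < pageDet g (Λ 0) (q 0)) :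
    0 < pageDet g (Λ 1) (q 1) := by
  by_contra hneg
  push Not at hneg
  have h1 : pageDet g (Λ 1) (q 1) < 0 := lt_of_le_of_ne hneg (hne 1 ⟨zero_le_one, le_rfl⟩)
  -- intermediate value theorem on `[0, 1]`
  have hivt := intermediate_value_Icc' (zero_le_one' ℝ) hc
  have hmem : (0 : ℝ) ∈ Icc (pageDet g (Λ 1) (q 1)) (pageDet g (Λ 0) (q 0)) := ⟨h1.le, h0.le⟩
  obtain ⟨t, ht, ht0⟩ := hivt hmem
  exact hne t ht ht0

/-- **Sub-goal `helper_pageDet_comp` of stub `stub_T3_dualPresentation`** (T3 ▸ T3c-2 ▸ ST4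
`node_ST4_twistSign`, brick X3-2a (page-orientation characters multiply); wave 5, lead c5):
multiplicativity of the page determinant `pageDet g Λ q = ⟪Λ(iτ), iΛτ⟫` (`τ = pageVec g q = (b, −a)`
the canonical tangent of the complex line `L_q = ker dΦ_q`): if `Λ₁` maps `τ(q)` and `iτ(q)` into
`L_{q'}` (`q' ≠ 0`) then `pageDet (Λ₂ ∘ Λ₁) q · ‖τ(q')‖² = pageDet Λ₁ q · pageDet Λ₂ q'`.
[cite: GriffithsHarris1978, Ch. 0 §2] -/
theorem helper_pageDet_comp : ∀ (g : ℕ) (Λ₁ Λ₂ : EuclideanSpace ℝ (Fin 4) →L[ℝ] EuclideanSpace ℝ (Fin 4)) (q q' : EuclideanSpace ℝ (Fin 4)), q' ≠ 0 → Literature.Topology.FourManifolds.LefschetzBase.dPhiX g q' * Literature.Topology.FourManifolds.LefschetzBase.cx (Λ₁ (Summit.SmoothPoincare4.SmoothPoincare4.Theorems.AcyclicBisectionExists.ModpBraidOrbits.pageVec g q)) + Literature.Topology.FourManifolds.LefschetzBase.dPhiY q' * Literature.Topology.FourManifolds.LefschetzBase.cy (Λ₁ (Summit.SmoothPoincare4.SmoothPoincare4.Theorems.AcyclicBisectionExists.ModpBraidOrbits.pageVec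 g q)) = 0 → Literature.Topology.FourManifolds.LefschetzBase.dPhiX g q' * Literature.Topology.FourManifolds.LefschetzBase.cx (Λ₁ (Literature.Topology.FourManifolds.LefschetzBase.cplxJ (Summit.SmoothPoincare4.SmoothPoincare4.Theorems.AcyclicBisectionExists.ModpBraidOrbits.pageVec g q))) + Literature.Topology.FourManifolds.LefschetzBase.dPhiY q' * Literature.Topology.FourManifolds.LefschetzBase.cy (Λ₁ (Literature.Topology.FourManifolds.LefschetzBase.cplxJ (Summit.SmoothPoincare4.SmoothPoincare4.Theorems.AcyclicBisectionExists.ModpBraidOrbits.pageVec g q))) = 0 → Summit.SmoothPoincare4.SmoothPoincare4.Theorems.AcyclicBisectionExists.ModpBraidOrbits.pageDet g (Λ₂.comp Λ₁) q * ‖Summit.SmoothPoincare4.SmoothPoincare4.Theorems.AcyclicBisectionExists.ModpBraidOrbits.pageVec g q'‖ ^ 2 = Summit.SmoothPoincare4.SmoothPoincare4.Theorems.AcyclicBisectionExists.ModpBraidOrbits.pageDet g Λ₁ q * Summit.SmoothPoincare4.SmoothPoincare4.Theorems.AcyclicBisectionExists.ModpBraidOrbits.pageDet g Λ₂ q' 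:=
  fun _ Λ₁ Λ₂ _ _ hq' h1 h2 => pageDet_comp Λ₁ Λ₂ hq' h1 h2

end Summit.SmoothPoincare4.SmoothPoincare4.Theorems.AcyclicBisectionExists.ModpBraidOrbits

end
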